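import Literature.MathematicalPhysics.QuantumFieldTheory.QCDPhaseQuenched
import Literature.MathematicalPhysics.QuantumLattice.GrassmannIntegralGaussianProofs
import HarnessLib

/-!
# Sign reweighting: the honest lattice-QCD functional from the phase-quenched one

Companion to `QCDPhaseQuenched.lean` (definition request `defn-qcdPhaseQuenchedExpect`).

## Content

* `fermiIntegral_fermiBoltzmann`: the Gaussian Berezin integral of the tree evaluates the fermionic
  partition function in the background `U` as `∫dψ̄dψ e^{−ψ̄D(U)ψ} = ε · det D(U)` with the universal
  orientation sign `ε = (−1)^{n(n−1)/2 + n}`, `n` the number of quark variables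
  (Montvay–Münster (4.17); tree `berezin_grassmannExp_quadratic_holds`).
* **Reweighting identity** `qcdTorusExpect_eq_phaseQuenched` (Mohler–Schaefer 2020 §2.1,
  `⟨A⟩ = ⟨A W⟩₊ / ⟨W⟩₊` with `W = det D/|det D|`): the honest signed functional `qcdTorusExpect` of
  `QCDOS.lean` is the phase-quenched expectation of `W · ⟨X⟩_F` divided by that of `W`, where
  `⟨X⟩_F(U) = ∫dψ̄dψ X e^{−ψ̄Dψ} / ∫dψ̄dψ e^{−ψ̄Dψ}` is the fermionic (Berezin) average in the
  background `U` — under the hypothesis that `det D(U) ≠ 0` for `μ_W`-a.e. `U` (where `det D = 0`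
  the Berezin ratio `⟨X⟩_F` is junk while `∫dψ̄dψ X e^{−ψ̄Dψ}` need not vanish).
* `isOpenPosMeasure_wilsonMeasure_fundamental` and `integral_norm_det_diracMatrix_pos_of_exists`:
  the Wilson measure charges open sets, so ONE configuration with `det D ≠ 0` makes the
  phase-quenched denominator positive (`qcdPhaseQuenchedExpect_const_of_exists`: `⟨c⟩₊ = c`).
* `qcdLatticeWeight_univ`, `isProbabilityMeasure_qcdLatticeMeasure`: the phase-quenched measure
  `qcdLatticeMeasure` of `QCD.lean` is a genuine probability measure once the denominator is
  positive; `qcdPhaseQuenchedExpect_jensen` (Jensen), `qcdPhaseQuenchedExpect_mono` (monotonicity);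
* `qcdPhaseQuenchedExpect_zero_flavours`: with no quarks the weight is `1` and `⟨·⟩₊` is the pure
  Wilson (Yang–Mills) expectation.

## Not here

That `{det D = 0}` is `μ_W`-null (true whenever `det D ≢ 0`, by real-analyticity in the links) is
not proved in the tree; it is the explicit hypothesis of the reweighting identity.
-/

noncomputable section

open MeasureTheory Filter
open Literature.MathematicalPhysics.QuantumLattice Literature.Probability.LatticeModels

namespace Literature.MathematicalPhysics.QuantumFieldTheory

variable {Nf : ℕ} {S : ℕ} [NeZero S]

/-- **Fermionic partition function in a background field**:
`∫dψ̄dψ e^{−ψ̄D(U)ψ} = (−1)^{n(n−1)/2 + n} det D(U)`, `n = #`quark variables (the tree's Gaussian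
Berezin formula `berezin (exp (ψ̄Aψ)) = (−1)^{n(n−1)/2} det A` at `A = −D`, and `det(−D) = (−1)^n det D`;
Montvay–Münster (4.17)). [cite: MontvayMunster1994, §4.1 (4.17)] -/
theorem fermiIntegral_fermiBoltzmann (U : GaugeConfig 4 S SU3) (mq : Fin Nf → ℝ) :
    fermiIntegral (fermiBoltzmann U mq) =
      (-1 : ℂ) ^ (Fintype.card (FermiIdx Nf S) * (Fintype.card (FermiIdx Nf S) - 1) / 2 +
          Fintype.card (FermiIdx Nf S)) * (diracMatrix U mq).det := by
  simp only [fermiIntegral, fermiBoltzmann]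
  rw [berezin_grassmannExp_quadratic_holds ℂ (ι := FermiIdx Nf S) (-diracMatrix U mq),
    Matrix.det_neg, pow_add, mul_assoc]

/-- The orientation sign is a unit: `(−1)^k ≠ 0` in `ℂ`. [folklore] -/
theorem fermiOrientationSign_ne_zero (k : ℕ) : ((-1 : ℂ) ^ k) ≠ 0 :=
  pow_ne_zero _ (neg_ne_zero.2 one_ne_zero)

/-- **Sign reweighting** (Mohler–Schaefer §2.1: "`⟨A⟩ = ⟨A W_s⟩₊/⟨W_s⟩₊`, with `⟨·⟩₊` the expectation
value in the theory with the modulus of the determinant taken", `W_s = det D_s/|det D_s|`): if the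
Wilson determinant vanishes only on a `μ_W`-null set, the honest lattice-QCD functional
`⟨X⟩ = ∫dμ_W ∫dψ̄dψ X e^{−ψ̄Dψ} / ∫dμ_W ∫dψ̄dψ e^{−ψ̄Dψ}` (`qcdTorusExpect`, signed determinant) equals
`⟨W · ⟨X⟩_F⟩₊ / ⟨W⟩₊`, where `⟨X⟩_F(U) = ∫dψ̄dψ X(U) e^{−ψ̄D(U)ψ} / ∫dψ̄dψ e^{−ψ̄D(U)ψ}` is the Berezin
average in the background `U` and `W = qcdDetPhase` the determinant sign. (The orientation sign of
the Berezin integral and the phase-quenched normalisation both cancel.) [cite: MohlerSchaefer2020, §2.1] -/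
theorem qcdTorusExpect_eq_phaseQuenched (β : ℝ) (mq : Fin Nf → ℝ)
    (X : GaugeConfig 4 S SU3 → FermiAlg Nf S)
    (h : ∀ᵐ U ∂(wilsonMeasure (d := 4) (L := S) (fundamentalRep (Fin 3)) β), (diracMatrix U mq).det ≠ 0) :
    qcdTorusExpect β S mq X =
      qcdPhaseQuenchedExpect β S mq (fun U => qcdDetPhase U mq *
          (fermiIntegral (X U * fermiBoltzmann U mq) / fermiIntegral (fermiBoltzmann U mq))) /
        qcdPhaseQuenchedExpect β S mq (fun U => qcdDetPhase U mq) := by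
  have hε := fermiOrientationSign_ne_zero
    (Fintype.card (FermiIdx Nf S) * (Fintype.card (FermiIdx Nf S) - 1) / 2 + Fintype.card (FermiIdx Nf S))
  have hW : (∫ U, (‖(diracMatrix U mq).det‖ : ℂ)
      ∂(wilsonMeasure (d := 4) (L := S) (fundamentalRep (Fin 3)) β)) ≠ 0 := by
    rw [integral_complex_ofReal, Complex.ofReal_ne_zero]
    exact (integral_norm_det_diracMatrix_pos β mq h).ne'
  have hnum : (fun U => (‖(diracMatrix U mq).det‖ : ℂ) * (qcdDetPhase U mq *
      (fermiIntegral (X U * fermiBoltzmann U mq) / fermiIntegral (fermiBoltzmann U mq))))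
      =ᵐ[wilsonMeasure (d := 4) (L := S) (fundamentalRep (Fin 3)) β]
      fun U => fermiIntegral (X U * fermiBoltzmann U mq) /
        (-1 : ℂ) ^ (Fintype.card (FermiIdx Nf S) * (Fintype.card (FermiIdx Nf S) - 1) / 2 +
          Fintype.card (FermiIdx Nf S)) := by
    filter_upwards [h] with U hU
    rw [← mul_assoc, norm_mul_qcdDetPhase, fermiIntegral_fermiBoltzmann]
    field_simp
  have hden : (fun U => (‖(diracMatrix U mq).det‖ : ℂ) * qcdDetPhase U mq)
      =ᵐ[wilsonMeasure (d := 4) (L := S) (fundamentalRep (Fin 3)) β]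
      fun U => fermiIntegral (fermiBoltzmann U mq) /
        (-1 : ℂ) ^ (Fintype.card (FermiIdx Nf S) * (Fintype.card (FermiIdx Nf S) - 1) / 2 +
          Fintype.card (FermiIdx Nf S)) :=
    Eventually.of_forall fun U => by
      beta_reduce
      rw [norm_mul_qcdDetPhase, fermiIntegral_fermiBoltzmann, mul_div_cancel_left₀ _ hε]
  rw [qcdPhaseQuenchedExpect_eq_div_complex, qcdPhaseQuenchedExpect_eq_div_complex,
    div_div_div_cancel_right₀ hW, integral_congr_ae hnum, integral_congr_ae hden, integral_div,
    integral_div, div_div_div_cancel_right₀ hε]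
  rfl

/-- **The Wilson measure charges every nonempty open set** of configurations: it is the product
Haar measure (open-positive) with the density `Z⁻¹ e^{−β S_W} ≥ Z⁻¹ e^{−|β| B} > 0`, `B` a bound for
the Wilson action of the finite torus. [folklore] -/
theorem isOpenPosMeasure_wilsonMeasure_fundamental (β : ℝ) :
    (wilsonMeasure (d := 4) (L := S) (fundamentalRep (Fin 3)) β).IsOpenPosMeasure := by
  obtain ⟨B, hB⟩ := exists_abs_wilsonAction_le (d := 4) (L := S) (fundamentalRep (Fin 3))
    (continuous_fundamentalRep _)
  obtain ⟨-, hZT⟩ := partitionFunction_fundamental_ne_zero_and_ne_top (S := S) β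
  haveI : (haarProbability SU3).IsOpenPosMeasure := by unfold haarProbability; infer_instance
  have hle : ENNReal.ofReal (Real.exp (-(|β| * B))) •
      (Measure.pi fun _ : Edge 4 S => haarProbability SU3) ≤
      wilsonWeight (d := 4) (L := S) (fundamentalRep (Fin 3)) β := by
    rw [wilsonWeight, ← withDensity_const]
    refine withDensity_mono (Eventually.of_forall fun U => ENNReal.ofReal_le_ofReal
      (Real.exp_le_exp.2 ?_))
    have h1 : β * wilsonAction (fundamentalRep (Fin 3)) U ≤ |β| * B :=
      (le_abs_self _).trans (by rw [abs_mul]; exact mul_le_mul_of_nonneg_left (hB U) (abs_nonneg β))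
    linarith
  refine ⟨fun O hO hne => ?_⟩
  simp only [wilsonMeasure, Measure.smul_apply, smul_eq_mul]
  refine mul_ne_zero (ENNReal.inv_ne_zero.2 hZT) (lt_of_lt_of_le ?_ (Measure.le_iff'.1 hle O)).ne'
  rw [Measure.smul_apply, smul_eq_mul]
  exact ENNReal.mul_pos (ENNReal.ofReal_pos.2 (Real.exp_pos _)).ne' (hO.measure_pos _ hne).ne'

/-- **Positivity of the denominator from one configuration**: if `det D(U₀) ≠ 0` for a single gauge
field `U₀` then `0 < ∫ |det D| dμ_W` — `U ↦ |det D(U)|` is continuous, hence positive on a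
neighbourhood of `U₀`, which the Wilson measure charges. (E.g. the free field `U ≡ 1` for bare masses
off the finitely many free doubler values.) [folklore] -/
theorem integral_norm_det_diracMatrix_pos_of_exists (β : ℝ) (mq : Fin Nf → ℝ)
    (h : ∃ U₀ : GaugeConfig 4 S SU3, (diracMatrix U₀ mq).det ≠ 0) :
    0 < ∫ U, ‖(diracMatrix U mq).det‖ ∂(wilsonMeasure (d := 4) (L := S) (fundamentalRep (Fin 3)) β) := by
  haveI := isOpenPosMeasure_wilsonMeasure_fundamental (S := S) β
  obtain ⟨U₀, hU₀⟩ := h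
  rw [integral_pos_iff_support_of_nonneg_ae (Eventually.of_forall fun U => norm_nonneg _)
    (integrable_norm_det_diracMatrix mq _)]
  exact (continuous_det_diracMatrix (S := S) mq).norm.isOpen_support.measure_pos _
    ⟨U₀, Function.mem_support.2 (norm_ne_zero_iff.2 hU₀)⟩

/-- With a configuration of nonzero determinant, `⟨·⟩₊` is normalised: `⟨c⟩₊ = c`. [folklore] -/
theorem qcdPhaseQuenchedExpect_const_of_exists {E : Type*} [NormedAddCommGroup E] [NormedSpace ℝ E]
    [CompleteSpace E] (β : ℝ) (mq : Fin Nf → ℝ)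
    (h : ∃ U₀ : GaugeConfig 4 S SU3, (diracMatrix U₀ mq).det ≠ 0) (c : E) :
    qcdPhaseQuenchedExpect β S mq (fun _ => c) = c :=
  qcdPhaseQuenchedExpect_const β mq (integral_norm_det_diracMatrix_pos_of_exists β mq h).ne' c

/-- **Total mass of the phase-quenched weight**: `∫ e^{−βS_W} ∏_f|det D_W| ∏dU = Z_W · ∫ |det D| dμ_W`
(`Z_W` the pure-gauge partition function, `μ_W` the Wilson probability measure). [folklore] -/
theorem qcdLatticeWeight_univ (β : ℝ) (mq : Fin Nf → ℝ) :
    qcdLatticeWeight S β mq Set.univ =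
      partitionFunction (d := 4) (L := S) (fundamentalRep (Fin 3)) β *
        ENNReal.ofReal (∫ U, ‖(diracMatrix U mq).det‖
          ∂(wilsonMeasure (d := 4) (L := S) (fundamentalRep (Fin 3)) β)) := by
  obtain ⟨hZ0, hZT⟩ := partitionFunction_fundamental_ne_zero_and_ne_top (S := S) β
  rw [qcdLatticeWeight, withDensity_apply _ MeasurableSet.univ, Measure.restrict_univ,
    ofReal_integral_eq_lintegral_ofReal (integrable_norm_det_diracMatrix mq _)
      (Eventually.of_forall fun _ => norm_nonneg _)]
  simp_rw [← norm_det_diracMatrix]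
  rw [wilsonMeasure, lintegral_smul_measure, smul_eq_mul, ← mul_assoc, ENNReal.mul_inv_cancel hZ0 hZT,
    one_mul]

/-- **The phase-quenched measure is a probability measure** as soon as its denominator
`∫ |det D| dμ_W` is positive (e.g. `det D ≠ 0` at one configuration,
`integral_norm_det_diracMatrix_pos_of_exists`): then `qcdLatticeMeasure S β mq` of `QCD.lean` —
`Z⁻¹ e^{−βS_W} ∏_f |det D_W(m_f)| ∏dU` — has total mass `1` (no junk). [cite: MontvayMunster1994, §5.1] -/
theorem isProbabilityMeasure_qcdLatticeMeasure (β : ℝ) (mq : Fin Nf → ℝ)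
    (h : 0 < ∫ U, ‖(diracMatrix U mq).det‖ ∂(wilsonMeasure (d := 4) (L := S) (fundamentalRep (Fin 3)) β)) :
    IsProbabilityMeasure (qcdLatticeMeasure S β mq) := by
  obtain ⟨hZ0, hZT⟩ := partitionFunction_fundamental_ne_zero_and_ne_top (S := S) β
  constructor
  rw [qcdLatticeMeasure, Measure.smul_apply, smul_eq_mul, qcdLatticeWeight_univ]
  exact ENNReal.inv_mul_cancel (mul_ne_zero hZ0 (ENNReal.ofReal_pos.2 h).ne')
    (ENNReal.mul_ne_top hZT ENNReal.ofReal_ne_top)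

/-- **Jensen's inequality for `⟨·⟩₊`**: for a convex continuous `g` on a closed convex `s ⊆ ℝ` and a
real observable `φ` with values a.e. in `s`, `g ⟨φ⟩₊ ≤ ⟨g ∘ φ⟩₊` — `⟨·⟩₊` is integration against the
probability measure `qcdLatticeMeasure` (Mathlib `ConvexOn.map_integral_le`). [folklore] -/
theorem qcdPhaseQuenchedExpect_jensen (β : ℝ) (mq : Fin Nf → ℝ)
    (h : 0 < ∫ U, ‖(diracMatrix U mq).det‖ ∂(wilsonMeasure (d := 4) (L := S) (fundamentalRep (Fin 3)) β))
    {s : Set ℝ} {g : ℝ → ℝ} (hg : ConvexOn ℝ s g) (hgc : ContinuousOn g s) (hs : IsClosed s)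
    (φ : GaugeConfig 4 S SU3 → ℝ) (hφs : ∀ᵐ U ∂(qcdLatticeMeasure S β mq), φ U ∈ s)
    (hφi : Integrable φ (qcdLatticeMeasure S β mq))
    (hgφi : Integrable (g ∘ φ) (qcdLatticeMeasure S β mq)) :
    g (qcdPhaseQuenchedExpect β S mq φ) ≤ qcdPhaseQuenchedExpect β S mq (g ∘ φ) := by
  haveI := isProbabilityMeasure_qcdLatticeMeasure (S := S) β mq h
  rw [qcdPhaseQuenchedExpect_eq_integral_qcdLatticeMeasure,
    qcdPhaseQuenchedExpect_eq_integral_qcdLatticeMeasure]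
  exact hg.map_integral_le hgc hs hφs hφi hgφi

/-- **Quenched limit `N_f = 0`**: without quarks the determinant weight is `1` and the phase-quenched
expectation is the pure-gauge Wilson expectation `∫ φ dμ_W` (Montvay–Münster §5.1, quenched
approximation = fermion determinant replaced by a constant). [cite: MontvayMunster1994, §5.1] -/
theorem qcdPhaseQuenchedExpect_zero_flavours {E : Type*} [NormedAddCommGroup E] [NormedSpace ℝ E]
    (β : ℝ) (mq : Fin 0 → ℝ) (φ : GaugeConfig 4 S SU3 → E) :
    qcdPhaseQuenchedExpect β S mq φ =
      ∫ U, φ U ∂(wilsonMeasure (d := 4) (L := S) (fundamentalRep (Fin 3)) β) := by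
  have h1 : ∀ U : GaugeConfig 4 S SU3, ‖(diracMatrix U mq).det‖ = 1 := fun U => by
    rw [norm_det_diracMatrix, Fin.prod_univ_zero]
  simp only [qcdPhaseQuenchedExpect, h1, one_smul, integral_const, probReal_univ, smul_eq_mul,
    mul_one, inv_one]

/-- **Monotonicity** for real observables with integrable weights: `φ ≤ ψ` a.e. implies
`⟨φ⟩₊ ≤ ⟨ψ⟩₊` (the weight `|det D|` and the normalisation are non-negative). [folklore] -/
theorem qcdPhaseQuenchedExpect_mono (β : ℝ) (mq : Fin Nf → ℝ) (φ ψ : GaugeConfig 4 S SU3 → ℝ)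
    (hφ : Integrable (fun U => ‖(diracMatrix U mq).det‖ * φ U)
      (wilsonMeasure (d := 4) (L := S) (fundamentalRep (Fin 3)) β))
    (hψ : Integrable (fun U => ‖(diracMatrix U mq).det‖ * ψ U)
      (wilsonMeasure (d := 4) (L := S) (fundamentalRep (Fin 3)) β))
    (hle : ∀ᵐ U ∂(wilsonMeasure (d := 4) (L := S) (fundamentalRep (Fin 3)) β), φ U ≤ ψ U) :
    qcdPhaseQuenchedExpect β S mq φ ≤ qcdPhaseQuenchedExpect β S mq ψ := by
  rw [qcdPhaseQuenchedExpect_eq_div, qcdPhaseQuenchedExpect_eq_div]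
  refine div_le_div_of_nonneg_right ?_ (integral_nonneg fun U => norm_nonneg _)
  refine integral_mono_ae hφ hψ ?_
  filter_upwards [hle] with U hU
  exact mul_le_mul_of_nonneg_left hU (norm_nonneg _)

/-- A bounded observable has an integrable phase-quenched weight `|det D| · φ` (the weight is
bounded and `μ_W` is a probability measure) — discharges the integrability hypotheses above for
all bounded measurable `φ`. [folklore] -/
theorem integrable_norm_det_diracMatrix_mul (β : ℝ) (mq : Fin Nf → ℝ) (φ : GaugeConfig 4 S SU3 → ℝ)
    (hφm : AEStronglyMeasurable φ (wilsonMeasure (d := 4) (L := S) (fundamentalRep (Fin 3)) β))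
    {C : ℝ} (hC : ∀ U, ‖φ U‖ ≤ C) :
    Integrable (fun U => ‖(diracMatrix U mq).det‖ * φ U)
      (wilsonMeasure (d := 4) (L := S) (fundamentalRep (Fin 3)) β) := by
  obtain ⟨B, hB⟩ := exists_norm_det_diracMatrix_le (S := S) mq
  refine Integrable.of_bound ((measurable_norm_det_diracMatrix mq).aestronglyMeasurable.mul hφm)
    (B * C) (Eventually.of_forall fun U => ?_)
  rw [norm_mul, Real.norm_eq_abs, abs_of_nonneg (norm_nonneg _)]
  exact mul_le_mul (hB U) (hC U) (norm_nonneg _) ((norm_nonneg _).trans (hB U))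

/-- **Lowering the exponent of a phase-quenched moment (Lyapunov / Jensen)**: for a non-negative
observable `Y` and `0 < s′ ≤ s`, `⟨Y^{s′}⟩₊ ≤ ⟨Y^s⟩₊^{s′/s}` — `t ↦ t^{s/s′}` is convex on `[0, ∞)`
and `⟨·⟩₊` is integration against the probability measure `qcdLatticeMeasure`
(`qcdPhaseQuenchedExpect_jensen`).  This is the step "lower the input's exponent to the one the
fibre bounds allow" of every fractional-moment bootstrap for the lattice quark propagator
(Aizenman–Schenker–Friedrich–Hundertmark 2001, proof of Thm 2). [folklore] -/
theorem qcdPhaseQuenchedExpect_rpow_le_rpow (β : ℝ) (mq : Fin Nf → ℝ)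
    (h : 0 < ∫ U, ‖(diracMatrix U mq).det‖ ∂(wilsonMeasure (d := 4) (L := S) (fundamentalRep (Fin 3)) β))
    (Y : GaugeConfig 4 S SU3 → ℝ) (hY0 : ∀ U, 0 ≤ Y U) {s' s : ℝ} (hs' : 0 < s') (hss : s' ≤ s)
    (hi' : Integrable (fun U => Y U ^ s') (qcdLatticeMeasure S β mq))
    (hi : Integrable (fun U => Y U ^ s) (qcdLatticeMeasure S β mq)) :
    qcdPhaseQuenchedExpect β S mq (fun U => Y U ^ s') ≤
      (qcdPhaseQuenchedExpect β S mq (fun U => Y U ^ s)) ^ (s' / s) := by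
  have hs : 0 < s := hs'.trans_le hss
  set p : ℝ := s / s' with hp
  have hp1 : 1 ≤ p := by rw [hp, le_div_iff₀ hs']; linarith
  have hp0 : 0 < p := one_pos.trans_le hp1
  -- Jensen for the convex power `t ↦ t^p` on `[0, ∞)` applied to `φ = Y^{s'}`, `(Y^{s'})^p = Y^s`
  have hcomp : (fun t : ℝ => t ^ p) ∘ (fun U => Y U ^ s') = fun U => Y U ^ s := by
    funext U
    simp only [Function.comp_apply]
    rw [← Real.rpow_mul (hY0 U), hp, mul_div_cancel₀ _ hs'.ne']
  have hJ := qcdPhaseQuenchedExpect_jensen (S := S) β mq h (convexOn_rpow hp1)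
    (Real.continuous_rpow_const hp0.le).continuousOn
    isClosed_Ici (fun U => Y U ^ s') (Eventually.of_forall fun U => Real.rpow_nonneg (hY0 U) _)
    hi' (by rw [hcomp]; exact hi)
  rw [hcomp] at hJ
  -- undo the power: `a^p ≤ b`, `a, b ≥ 0` ⇒ `a ≤ b^{1/p} = b^{s'/s}`
  have ha : 0 ≤ qcdPhaseQuenchedExpect β S mq (fun U => Y U ^ s') := by
    rw [qcdPhaseQuenchedExpect_eq_integral_qcdLatticeMeasure]
    exact integral_nonneg fun U => Real.rpow_nonneg (hY0 U) _
  have hb : 0 ≤ qcdPhaseQuenchedExpect β S mq (fun U => Y U ^ s) := by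
    rw [qcdPhaseQuenchedExpect_eq_integral_qcdLatticeMeasure]
    exact integral_nonneg fun U => Real.rpow_nonneg (hY0 U) _
  have hinv : s' / s = p⁻¹ := by rw [hp, inv_div]
  calc qcdPhaseQuenchedExpect β S mq (fun U => Y U ^ s')
      = ((qcdPhaseQuenchedExpect β S mq (fun U => Y U ^ s')) ^ p) ^ p⁻¹ := by
        rw [Real.rpow_rpow_inv ha hp0.ne']
    _ ≤ (qcdPhaseQuenchedExpect β S mq (fun U => Y U ^ s)) ^ p⁻¹ :=
        Real.rpow_le_rpow (Real.rpow_nonneg ha _) hJ (inv_nonneg.2 hp0.le)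
    _ = (qcdPhaseQuenchedExpect β S mq (fun U => Y U ^ s)) ^ (s' / s) := by rw [hinv]

end Literature.MathematicalPhysics.QuantumFieldTheory

end
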